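import Summits.KontsevichZagierPeriods.KontsevichZagierPeriods.Theorems.RootDecompRationalCubeDichotomyNashMultiGenP08

/-! # `RootDecompRationalCubeDichotomyNashMultiGenP09` — part 9/16 of the mechanical ≤385-line split of `NashEtaleMultiGen.lean`
(split by the decomp-kz census seat for landing; mathematics unchanged; part 9 continues part 8). -/

open Set MvPolynomial Filter Topology
open Literature.NumberTheory.Transcendental (IsSemialgebraicFunOn)
open Literature.ModelTheory.ExponentialFields (IsSemialgebraic isSemialgebraic_setOf_eval_pos
  isSemialgebraic_setOf_eval_ne_zero)

namespace Summit.KontsevichZagierPeriods.RootDecompRationalCubeDichotomy.Rung29430.MultiGen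
open Summit.KontsevichZagierPeriods.KontsevichZagierPeriods.Theses.RootDecompRationalCubeDichotomy
  (NashEtaleCover NashEtaleLocal PiRationalisation)
open Summit.KontsevichZagierPeriods.RootDecompRationalCubeDichotomy.Rung29430.NashEtaleLocalGlue
  (local_of_simple nashEtaleCover_of_nashEtaleLocal nashEtaleLocal_zero)
open Summit.KontsevichZagierPeriods.RootDecompRationalCubeDichotomy.Rung29430.NashEtaleLocalOne
  (analyticOnNhd_aeval_snoc)
open Summit.KontsevichZagierPeriods.RootDecompRationalCubeDichotomy.RungEtale.Etale
  (piRationalisation_of_nashEtaleCover)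

noncomputable section

/-- `PointDataAt n g x₀`: a point `y₀ ∈ ℝᵏ`, an étale system `F` at `(x₀, y₀)`, `A`, `B` with
`B(x₀, y₀) ≠ 0`, and the identification `g = A(x,u)/B(x,u)` near `x₀` along every local analytic
solution `u` of `F(x, u) = 0` through `y₀`. -/
def PointDataAt (n : ℕ) (g : (Fin n → ℝ) → ℝ) (x₀ : Fin n → ℝ) : Prop :=
  ∃ (k : ℕ) (y₀ : Fin k → ℝ) (F : Fin k → MvPolynomial (Fin (n + k)) ℚ)
    (A B : MvPolynomial (Fin (n + k)) ℚ),
    (∀ i, MvPolynomial.aeval (Fin.append x₀ y₀) (F i) = 0) ∧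
    (Matrix.of fun i j : Fin k =>
      MvPolynomial.aeval (Fin.append x₀ y₀) (pderiv (Fin.natAdd n j) (F i))).det ≠ 0 ∧
    MvPolynomial.aeval (Fin.append x₀ y₀) B ≠ 0 ∧
    ∀ (V : Set (Fin n → ℝ)) (u : Fin k → (Fin n → ℝ) → ℝ), IsOpen V → x₀ ∈ V →
      (∀ j, u j x₀ = y₀ j) → (∀ j, AnalyticOnNhd ℝ (u j) V) →
      (∀ x ∈ V, ∀ i, MvPolynomial.aeval (Fin.append x fun j => u j x) (F i) = 0) →
      ∃ V' ⊆ V, IsOpen V' ∧ x₀ ∈ V' ∧ ∀ x ∈ V',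
        g x = MvPolynomial.aeval (Fin.append x fun j => u j x) A /
          MvPolynomial.aeval (Fin.append x fun j => u j x) B

/-- Point data give `MultiGenData` (§4f). -/
theorem exists_multiGenData_of_pointDataAt {n : ℕ} {g : (Fin n → ℝ) → ℝ} {x₀ : Fin n → ℝ}
    (h : PointDataAt n g x₀) : ∃ k, MultiGenData n k g x₀ := by
  obtain ⟨k, y₀, F, A, B, hF, hJ, hB, hg⟩ := h
  exact ⟨k, multiGenData_of_pointData y₀ F A B hF hJ hB hg⟩

/-- Conversely `MultiGenData` gives point data: the identification along ANY other analytic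
solution holds by local uniqueness of solutions (`NashImplicit.solutions_eq_near`). -/
theorem pointDataAt_of_multiGenData {n k : ℕ} {g : (Fin n → ℝ) → ℝ} {x₀ : Fin n → ℝ}
    (h : MultiGenData n k g x₀) : PointDataAt n g x₀ := by
  obtain ⟨V, u, F, A, B, hVo, hx₀, -, huan, hFu, hJ, hgB⟩ := h
  refine ⟨k, fun j => u j x₀, F, A, B, fun i => hFu x₀ hx₀ i, hJ, (hgB x₀ hx₀).1, ?_⟩
  intro V₁ v hV₁o hx₀V₁ hv₀ hvan hFv
  obtain ⟨W, hWo, hx₀W, hWsub, hW⟩ := NashImplicit.solutions_eq_near F x₀ (fun j => u j x₀) hJ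
    (hVo.inter hV₁o) ⟨hx₀, hx₀V₁⟩ (u := u) (v := v) (fun _ => rfl) hv₀
    (fun j => (huan j x₀ hx₀).continuousAt) (fun j => (hvan j x₀ hx₀V₁).continuousAt)
    (fun x hx => hFu x hx.1) (fun x hx => hFv x hx.2)
  refine ⟨W, fun x hx => (hWsub hx).2, hWo, hx₀W, fun x hx => ?_⟩
  have huv : (Fin.append x fun j => v j x) = Fin.append x fun j => u j x := by
    congr 1
    funext j
    exact (hW x hx j).symm
  rw [huv]
  exact (hgB x (hWsub hx).1).2

/-- Hence point data and many-generator data are EQUIVALENT at every point. -/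
theorem pointDataAt_iff {n : ℕ} {g : (Fin n → ℝ) → ℝ} {x₀ : Fin n → ℝ} :
    PointDataAt n g x₀ ↔ ∃ k, MultiGenData n k g x₀ :=
  ⟨exists_multiGenData_of_pointDataAt, fun ⟨_, h⟩ => pointDataAt_of_multiGenData h⟩

/-- `SpecialPointData n`: every `ℚ`-Nash `g` near the closed cube has étale point data at every
NON-GENERIC point of the cube (the generic points are settled, §4). -/
def SpecialPointData (n : ℕ) : Prop :=
  ∀ (g : (Fin n → ℝ) → ℝ) (U : Set (Fin n → ℝ)), IsOpen U →
    Set.pi Set.univ (fun _ : Fin n => Set.Icc (0:ℝ) 1) ⊆ U →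
    IsSemialgebraicFunOn ℚ U g → AnalyticOnNhd ℝ g U →
    ∀ x₀ ∈ Set.pi Set.univ (fun _ : Fin n => Set.Icc (0:ℝ) 1),
      ¬ AlgebraicIndependent ℚ x₀ → PointDataAt n g x₀

/-- `SpecialPointData n → MultiGenAt n` (generic points by §4, special points by §4f). -/
theorem multiGenAt_of_specialPointData {n : ℕ} (h : SpecialPointData n) : MultiGenAt n := by
  intro g U hU hKU hsa han x₀ hx₀
  by_cases hind : AlgebraicIndependent ℚ x₀
  · exact ⟨1, multiGenData_of_algebraicIndependent hU hsa han (hKU hx₀) hind⟩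
  · exact exists_multiGenData_of_pointDataAt (h g U hU hKU hsa han x₀ hx₀ hind)

/-- … and conversely, so `SpecialPointData n ↔ MultiGenAt n` (↔ `NashEtaleLocalAt n`, §5). -/
theorem specialPointData_of_multiGenAt {n : ℕ} (h : MultiGenAt n) : SpecialPointData n :=
  fun g U hU hKU hsa han x₀ hx₀ _ =>
    let ⟨_, hk⟩ := h g U hU hKU hsa han x₀ hx₀
    pointDataAt_of_multiGenData hk

/-- Auxiliary step `specialPointData_iff_multiGenAt`. [bookkeeping] -/
theorem specialPointData_iff_multiGenAt {n : ℕ} : SpecialPointData n ↔ MultiGenAt n :=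
  ⟨multiGenAt_of_specialPointData, specialPointData_of_multiGenAt⟩

/-- … and `SpecialPointData n ↔ NashEtaleLocalAt n`: the per-dimension slice of item 31659 is
EQUIVALENT to étale point data at the non-generic points of the cube. -/
theorem specialPointData_iff_nashEtaleLocalAt {n : ℕ} : SpecialPointData n ↔ NashEtaleLocalAt n :=
  specialPointData_iff_multiGenAt.trans nashEtaleLocalAt_iff_multiGenAt.symm

/-- Evidence (WEAKER than piece M up to §4f): the strata pieces follow from point data. -/
theorem strata_of_specialPointData {n : ℕ} (h : SpecialPointData n) :
    MultiGenDefectOneAt n ∧ MultiGenSpecialAt n :=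
  ⟨multiGenDefectOneAt_of_multiGenAt (multiGenAt_of_specialPointData h),
    multiGenSpecialAt_of_multiGenAt (multiGenAt_of_specialPointData h)⟩

/-- **Item 31659 from étale point data at the special points of the cube, all `n ≥ 1`.** -/
theorem nashEtaleLocal_of_specialPointData (h : ∀ n, 1 ≤ n → SpecialPointData n) :
    NashEtaleLocal :=
  nashEtaleLocal_of_multiGen fun n hn => multiGenAt_of_specialPointData (h n hn)

/-- … hence the support 29430 `NashEtaleCover` … -/
theorem nashEtaleCover_of_specialPointData (h : ∀ n, 1 ≤ n → SpecialPointData n) :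
    NashEtaleCover :=
  nashEtaleCover_of_nashEtaleLocal (nashEtaleLocal_of_specialPointData h)

/-- … and crux 24903 `PiRationalisation`. -/
theorem piRationalisation_of_specialPointData (h : ∀ n, 1 ≤ n → SpecialPointData n) :
    PiRationalisation :=
  piRationalisation_of_nashEtaleCover (nashEtaleCover_of_specialPointData h)

/-- The v3 glue claim (UNDECIDED — the formal identification): the THEOREM-IN-PRINT
`EtaleAlgebraicPowerSeries` yields étale point data at every special point.  Mechanism: §4d chart
`(s, t)` at `x₀`; Taylor series of `g` in `t` over the generic `ℚ`-Nash germs in `s` is algebraic;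
the fact gives `(F, A, B)` formally; the identification holds because the analytic solution `u`
of §4e has the formal solution as Taylor series (uniqueness of the simple formal root). -/
def SpecialPointDataViaPowerSeries : Prop :=
  (∀ d, EtaleAlgebraicPowerSeries d) → ∀ n, 1 ≤ n → SpecialPointData n

/-! ### Point data BY STRATUM (critic 12:08Z: two supports that distribute)

`PointDataDefectOneAt n` (defect exactly `1` — the DVR case, ATTACKABLE-NOW) and
`PointDataDefectTwoAt n` (defect `≥ 2` — the core), each EQUIVALENT to the corresponding
many-generator stratum piece (`pointDataAt_iff`), with the `by_cases` glue to item 31659. -/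

/-- Point data on the DEFECT-ONE stratum of the closed unit cube. -/
def PointDataDefectOneAt (n : ℕ) : Prop :=
  ∀ (g : (Fin n → ℝ) → ℝ) (U : Set (Fin n → ℝ)), IsOpen U →
    Set.pi Set.univ (fun _ : Fin n => Set.Icc (0:ℝ) 1) ⊆ U →
    IsSemialgebraicFunOn ℚ U g → AnalyticOnNhd ℝ g U →
    ∀ x₀ ∈ Set.pi Set.univ (fun _ : Fin n => Set.Icc (0:ℝ) 1),
      ¬ AlgebraicIndependent ℚ x₀ → DefectLeOne x₀ → PointDataAt n g x₀

/-- Point data on the DEFECT-`≥ 2` stratum of the closed unit cube. -/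
def PointDataDefectTwoAt (n : ℕ) : Prop :=
  ∀ (g : (Fin n → ℝ) → ℝ) (U : Set (Fin n → ℝ)), IsOpen U →
    Set.pi Set.univ (fun _ : Fin n => Set.Icc (0:ℝ) 1) ⊆ U →
    IsSemialgebraicFunOn ℚ U g → AnalyticOnNhd ℝ g U →
    ∀ x₀ ∈ Set.pi Set.univ (fun _ : Fin n => Set.Icc (0:ℝ) 1),
      ¬ DefectLeOne x₀ → PointDataAt n g x₀

/-- Auxiliary step `pointDataDefectOneAt_iff`. [bookkeeping] -/
theorem pointDataDefectOneAt_iff {n : ℕ} : PointDataDefectOneAt n ↔ MultiGenDefectOneAt n := by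
  refine ⟨fun h g U hU hKU hsa han x₀ hx₀ hni hd => ?_, fun h g U hU hKU hsa han x₀ hx₀ hni hd => ?_⟩
  · exact pointDataAt_iff.mp (h g U hU hKU hsa han x₀ hx₀ hni hd)
  · exact pointDataAt_iff.mpr (h g U hU hKU hsa han x₀ hx₀ hni hd)

/-- Auxiliary step `pointDataDefectTwoAt_iff`. [bookkeeping] -/
theorem pointDataDefectTwoAt_iff {n : ℕ} : PointDataDefectTwoAt n ↔ MultiGenSpecialAt n := by
  refine ⟨fun h g U hU hKU hsa han x₀ hx₀ hd => ?_, fun h g U hU hKU hsa han x₀ hx₀ hd => ?_⟩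
  · exact pointDataAt_iff.mp (h g U hU hKU hsa han x₀ hx₀ hd)
  · exact pointDataAt_iff.mpr (h g U hU hKU hsa han x₀ hx₀ hd)

/-- `PointDataDefectTwoAt 1` is vacuous (no defect-2 points on the segment). -/
theorem pointDataDefectTwoAt_one : PointDataDefectTwoAt 1 :=
  pointDataDefectTwoAt_iff.mpr multiGenSpecialAt_one

/-- The two point-data supports glue to item 31659 … -/
theorem nashEtaleLocal_of_pointDataStrata (h₁ : ∀ n, 1 ≤ n → PointDataDefectOneAt n)
    (h₂ : ∀ n, 2 ≤ n → PointDataDefectTwoAt n) : NashEtaleLocal :=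
  nashEtaleLocal_of_strata (fun n hn => pointDataDefectOneAt_iff.mp (h₁ n hn))
    (fun n hn => pointDataDefectTwoAt_iff.mp (h₂ n hn))

/-- … to the support 29430 … -/
theorem nashEtaleCover_of_pointDataStrata (h₁ : ∀ n, 1 ≤ n → PointDataDefectOneAt n)
    (h₂ : ∀ n, 2 ≤ n → PointDataDefectTwoAt n) : NashEtaleCover :=
  nashEtaleCover_of_nashEtaleLocal (nashEtaleLocal_of_pointDataStrata h₁ h₂)

/-- … and to the crux 24903. -/
theorem piRationalisation_of_pointDataStrata (h₁ : ∀ n, 1 ≤ n → PointDataDefectOneAt n)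
    (h₂ : ∀ n, 2 ≤ n → PointDataDefectTwoAt n) : PiRationalisation :=
  piRationalisation_of_nashEtaleCover (nashEtaleCover_of_pointDataStrata h₁ h₂)

/-- Conversely both supports follow from item 31659's slice (so they are EQUIV re-typings of the
two strata of `NashEtaleLocalAt n`, not weakenings of the item as a whole). -/
theorem pointDataStrata_of_nashEtaleLocalAt {n : ℕ} (h : NashEtaleLocalAt n) :
    PointDataDefectOneAt n ∧ PointDataDefectTwoAt n :=
  ⟨pointDataDefectOneAt_iff.mpr
      (multiGenDefectOneAt_of_multiGenAt (nashEtaleLocalAt_iff_multiGenAt.mp h)),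
    pointDataDefectTwoAt_iff.mpr
      (multiGenSpecialAt_of_multiGenAt (nashEtaleLocalAt_iff_multiGenAt.mp h))⟩

/-- Item 31659 from the fact and the v3 glue. -/
theorem nashEtaleLocal_of_fact' (hF : ∀ d, EtaleAlgebraicPowerSeries d)
    (hG : SpecialPointDataViaPowerSeries) : NashEtaleLocal :=
  nashEtaleLocal_of_specialPointData (hG hF)

/-- Crux 24903 from the fact and the v3 glue. -/
theorem piRationalisation_of_fact' (hF : ∀ d, EtaleAlgebraicPowerSeries d)
    (hG : SpecialPointDataViaPowerSeries) : PiRationalisation :=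
  piRationalisation_of_specialPointData (hG hF)

/-! ## §5e  Product-point form (v4): the narrowest typed open piece

By the PROVED transport §4g, item 31659 follows from piece M at SPECIAL PRODUCT POINTS
`(generic, 0)` alone; there, many-generator data = point data (`pointDataAt_iff`). -/

/-- `SpecialProductPointData n`: étale POINT data for every `ℚ`-Nash germ at every special
product point of `ℝⁿ` — equivalent to `ProductPointMultiGen n` (`pointDataAt_iff`). -/
def SpecialProductPointData (n : ℕ) : Prop :=
  ∀ y₀ : Fin n → ℝ, IsProductPoint y₀ → ¬ AlgebraicIndependent ℚ y₀ →
    ∀ (g : (Fin n → ℝ) → ℝ) (U : Set (Fin n → ℝ)), IsOpen U → y₀ ∈ U →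
      IsSemialgebraicFunOn ℚ U g → AnalyticOnNhd ℝ g U → PointDataAt n g y₀

/-- Auxiliary step `specialProductPointData_iff`. [bookkeeping] -/
theorem specialProductPointData_iff {n : ℕ} :
    SpecialProductPointData n ↔ ProductPointMultiGen n := by
  refine ⟨fun h y₀ hp hs g U hU hy₀ hsa han => ?_, fun h y₀ hp hs g U hU hy₀ hsa han => ?_⟩
  · exact pointDataAt_iff.mp (h y₀ hp hs g U hU hy₀ hsa han)
  · exact pointDataAt_iff.mpr (h y₀ hp hs g U hU hy₀ hsa han)

/-- `ProductPointMultiGen n ↔ NashEtaleLocalAt n`: the product-point piece is a RE-TYPING of the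
`n`-slice of item 31659 (EQUIV), whose content is WHERE one has to work: special product points. -/
theorem productPointMultiGen_iff_nashEtaleLocalAt {n : ℕ} :
    ProductPointMultiGen n ↔ NashEtaleLocalAt n :=
  productPointMultiGen_iff_multiGenAt.trans nashEtaleLocalAt_iff_multiGenAt.symm

/-- Item 31659 from piece M at special product points in every positive dimension. -/
theorem nashEtaleLocal_of_productPointMultiGen (h : ∀ n, 1 ≤ n → ProductPointMultiGen n) :
    NashEtaleLocal :=
  nashEtaleLocal_of_multiGen fun n hn => multiGenAt_of_productPointMultiGen (h n hn)

/-- … and from point data at special product points. -/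
theorem nashEtaleLocal_of_specialProductPointData
    (h : ∀ n, 1 ≤ n → SpecialProductPointData n) : NashEtaleLocal :=
  nashEtaleLocal_of_productPointMultiGen fun n hn => specialProductPointData_iff.mp (h n hn)

/-- … hence the support 29430 and the CRUX 24903 `PiRationalisation`. -/
theorem nashEtaleCover_of_productPointMultiGen (h : ∀ n, 1 ≤ n → ProductPointMultiGen n) :
    NashEtaleCover :=
  nashEtaleCover_of_nashEtaleLocal (nashEtaleLocal_of_productPointMultiGen h)

/-- Auxiliary step `piRationalisation_of_productPointMultiGen`. [bookkeeping] -/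
theorem piRationalisation_of_productPointMultiGen (h : ∀ n, 1 ≤ n → ProductPointMultiGen n) :
    PiRationalisation :=
  piRationalisation_of_nashEtaleCover (nashEtaleCover_of_productPointMultiGen h)

/-- Auxiliary step `piRationalisation_of_specialProductPointData`. [bookkeeping] -/
theorem piRationalisation_of_specialProductPointData
    (h : ∀ n, 1 ≤ n → SpecialProductPointData n) : PiRationalisation :=
  piRationalisation_of_productPointMultiGen fun n hn => specialProductPointData_iff.mp (h n hn)

/-- The strata / point-data pieces of v2/v3 all follow from the product-point piece. -/
theorem specialPointData_of_productPointMultiGen {n : ℕ} (h : ProductPointMultiGen n) :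
    SpecialPointData n :=
  specialPointData_of_multiGenAt (multiGenAt_of_productPointMultiGen h)

/-- The v4 glue claim (UNDECIDED — the formal identification, now at product points only): the
THEOREM-IN-PRINT `EtaleAlgebraicPowerSeries` yields many-generator data for `ℚ`-Nash germs at
special product points `(s₀, 0)`, `s₀` generic.  Mechanism (§3 of NODE.md with the chart step
REMOVED — coordinates are already `(s, t)`): Taylor series of `G` in `t` has coefficients in the
FIELD `K₀` of generic `ℚ`-Nash germs in `s` (`eventually_eq_zero_of_generic`), is algebraic over
`K₀(t)`, the fact gives an étale `(F, A, B)` over `K₀`; adjoin the coefficients (simple roots of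
their minimal polynomials over `ℚ(s)`, §4 `irreducible_of_minimal`) as further generators;
identification by the identity principle. -/
def ProductPointViaPowerSeries : Prop :=
  (∀ d, EtaleAlgebraicPowerSeries d) → ∀ n, 1 ≤ n → ProductPointMultiGen n

/-- Auxiliary step `nashEtaleLocal_of_fact''`. [bookkeeping] -/
theorem nashEtaleLocal_of_fact'' (hF : ∀ d, EtaleAlgebraicPowerSeries d)
    (hG : ProductPointViaPowerSeries) : NashEtaleLocal :=
  nashEtaleLocal_of_productPointMultiGen (hG hF)

/-- Auxiliary step `piRationalisation_of_fact''`. [bookkeeping] -/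
theorem piRationalisation_of_fact'' (hF : ∀ d, EtaleAlgebraicPowerSeries d)
    (hG : ProductPointViaPowerSeries) : PiRationalisation :=
  piRationalisation_of_productPointMultiGen (hG hF)

/-! ## §5d  Worked example (evidence): point data BY HAND at a special point

`n = 1`, the special (algebraic) point `x₀ = 0`, `g(x) = x·√(1+x)` — a `ℚ`-Nash germ whose
minimal relation `w² − x²(1+x)` is NOT simple at `(0, g 0) = (0, 0)` (both branches `±x√(1+x)`
pass through it), so the landed `local_of_simple` does not apply.  Point data: `k = 1`, `y₀ = 1`,
`F = y² − 1 − x` (étale at `(0,1)`: `∂F/∂y = 2`), `A = x·y`, `B = 1`; the IDENTIFICATION along an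
arbitrary analytic solution `u` through `1` is done by positivity: `u > 0` near `0`, `u² = 1 + x`,
hence `u = √(1+x)` and `g = x·u`.  (This is the pattern a prover uses when the branch is pinned by
an inequality; in general it is pinned by the Taylor series — the formal half of the glue.) -/

/-- The example germ `x ↦ x·√(1+x)` on `ℝ¹`. -/
def gEx (x : Fin 1 → ℝ) : ℝ := x 0 * Real.sqrt (1 + x 0)

/-- `Fin.append a b 0 = a 0` and `Fin.append a b 1 = b 0` on `Fin 1 + Fin 1 = Fin 2`. -/
private theorem append_fin_one_zero (a b : Fin 1 → ℝ) : Fin.append a b 0 = a 0 := Fin.append_left a b 0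

/-- Auxiliary step `append_fin_one_one`. [bookkeeping] -/
private theorem append_fin_one_one (a b : Fin 1 → ℝ) : Fin.append a b 1 = b 0 := by
  simpa using Fin.append_right a b 0

/-- Auxiliary step `pointDataAt_gEx`. [bookkeeping] -/
theorem pointDataAt_gEx : PointDataAt 1 gEx (fun _ => 0) := by
  classical
  -- variables `x = X (castAdd 1 0) = X 0`, `y = X (natAdd 1 0) = X 1` of `ℚ[x, y]`
  refine ⟨1, fun _ => 1, fun _ => X (Fin.natAdd 1 0) ^ 2 - 1 - X (Fin.castAdd 1 0),
    X (Fin.castAdd 1 0) * X (Fin.natAdd 1 0), 1, ?_, ?_, ?_, ?_⟩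
  · intro i
    simp [append_fin_one_zero, append_fin_one_one]
  · -- the `1 × 1` Jacobian is `∂F/∂y (0, 1) = 2`
    simp [Matrix.det_unique, Derivation.leibniz_pow, append_fin_one_one]
  · simp
  · intro V u hV hx₀ hu₀ huan hFu
    have hcont : ContinuousOn (u 0) V := fun x hx => (huan 0 x hx).continuousAt.continuousWithinAt
    refine ⟨V ∩ u 0 ⁻¹' Set.Ioi 0, Set.inter_subset_left, hcont.isOpen_inter_preimage hV isOpen_Ioi,
      ⟨hx₀, by rw [Set.mem_preimage, hu₀ 0]; exact Set.mem_Ioi.mpr one_pos⟩, fun x hx => ?_⟩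
    have hpos : 0 < u 0 x := hx.2
    have hrel := hFu x hx.1 0
    simp only [map_sub, map_pow, MvPolynomial.aeval_X, Fin.append_right, map_one,
      Fin.append_left, sub_eq_zero] at hrel
    -- hrel : u 0 x ^ 2 - 1 = x 0  (or a variant); derive 1 + x 0 = (u 0 x)^2
    have hsq : 1 + x 0 = u 0 x ^ 2 := by linarith
    have hsqrt : Real.sqrt (1 + x 0) = u 0 x := by
      rw [hsq, Real.sqrt_sq hpos.le]
    simp [gEx, hsqrt, append_fin_one_zero, append_fin_one_one]

/-- The example point is special (not algebraically independent). -/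
theorem not_algebraicIndependent_zero : ¬ AlgebraicIndependent ℚ (fun _ : Fin 1 => (0 : ℝ)) := by
  intro h
  have := algebraicIndependent_iff.mp h (X 0) (by simp)
  exact X_ne_zero (R := ℚ) (0 : Fin 1) this

/-- … so the example exhibits `MultiGenData` at a special point through the consumer form. -/
theorem exists_multiGenData_gEx : ∃ k, MultiGenData 1 k gEx (fun _ => 0) :=
  exists_multiGenData_of_pointDataAt pointDataAt_gEx

/-! ### The critic's defect-2 test on the square: `g = √(1+x+y)` at `(½, ½)`

Both coordinates rational, so `x₀ = (½, ½)` has defect `2` (`not_defectLeOne_two_iff`); point data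
by hand: `k = 1`, `y₀ = √2`, `F = u² − 1 − x − y` (`∂F/∂u (x₀, √2) = 2√2 ≠ 0`), `A = u`, `B = 1`,
identification by positivity. -/

/-- The example germ `(x, y) ↦ √(1 + x + y)` on `ℝ²`. -/
def gEx2 (x : Fin 2 → ℝ) : ℝ := Real.sqrt (1 + x 0 + x 1)

/-- Auxiliary step `append_fin_two_one_zero`. [bookkeeping] -/
theorem append_fin_two_one_zero (a : Fin 2 → ℝ) (b : Fin 1 → ℝ) : Fin.append a b 0 = a 0 := by
  simpa using Fin.append_left a b 0

/-- Auxiliary step `append_fin_two_one_one`. [bookkeeping] -/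
theorem append_fin_two_one_one (a : Fin 2 → ℝ) (b : Fin 1 → ℝ) : Fin.append a b 1 = a 1 := by
  simpa using Fin.append_left a b 1

/-- Auxiliary step `append_fin_two_one_two`. [bookkeeping] -/
theorem append_fin_two_one_two (a : Fin 2 → ℝ) (b : Fin 1 → ℝ) : Fin.append a b 2 = b 0 := by
  simpa using Fin.append_right a b 0

/-- Auxiliary step `pointDataAt_gEx2`. [bookkeeping] -/
theorem pointDataAt_gEx2 : PointDataAt 2 gEx2 (fun _ => 1 / 2) := by
  classical
  have hs2 : Real.sqrt 2 ^ 2 = 2 := Real.sq_sqrt (by norm_num)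
  have hs2pos : 0 < Real.sqrt 2 := Real.sqrt_pos.mpr (by norm_num)
  refine ⟨1, fun _ => Real.sqrt 2,
    fun _ => X (Fin.natAdd 2 0) ^ 2 - 1 - X (Fin.castAdd 1 0) - X (Fin.castAdd 1 1),
    X (Fin.natAdd 2 0), 1, ?_, ?_, ?_, ?_⟩
  · intro i
    simp [append_fin_two_one_zero, append_fin_two_one_one, append_fin_two_one_two, hs2]
    norm_num
  · simp [Matrix.det_unique, Derivation.leibniz_pow, append_fin_two_one_two, hs2pos.ne']
  · simp
  · intro V u hV hx₀ hu₀ huan hFu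
    have hcont : ContinuousOn (u 0) V := fun x hx => (huan 0 x hx).continuousAt.continuousWithinAt
    refine ⟨V ∩ u 0 ⁻¹' Set.Ioi 0, Set.inter_subset_left, hcont.isOpen_inter_preimage hV isOpen_Ioi,
      ⟨hx₀, by rw [Set.mem_preimage, hu₀ 0]; exact Set.mem_Ioi.mpr hs2pos⟩, fun x hx => ?_⟩
    have hpos : 0 < u 0 x := hx.2
    have hrel := hFu x hx.1 0
    simp only [map_sub, map_pow, MvPolynomial.aeval_X, Fin.append_left, Fin.append_right, map_one,
      sub_eq_zero] at hrel
    have hsq : 1 + x 0 + x 1 = u 0 x ^ 2 := by linarith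
    have hsqrt : Real.sqrt (1 + x 0 + x 1) = u 0 x := by
      rw [hsq, Real.sqrt_sq hpos.le]
    simp [gEx2, hsqrt, append_fin_two_one_two]

/-- The test point has defect `2`. -/
theorem not_defectLeOne_half_half : ¬ DefectLeOne (fun _ : Fin 2 => (1 / 2 : ℝ)) := by
  rw [not_defectLeOne_two_iff]
  have h : IsAlgebraic ℚ ((1 / 2 : ℚ) : ℝ) := isAlgebraic_algebraMap _
  have e : ((1 / 2 : ℚ) : ℝ) = 1 / 2 := by push_cast; ring
  rw [e] at h
  exact ⟨h, h⟩

/-- Auxiliary step `exists_multiGenData_gEx2`. [bookkeeping] -/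
theorem exists_multiGenData_gEx2 : ∃ k, MultiGenData 2 k gEx2 (fun _ => 1 / 2) :=
  exists_multiGenData_of_pointDataAt pointDataAt_gEx2

end
end Summit.KontsevichZagierPeriods.RootDecompRationalCubeDichotomy.Rung29430.MultiGen
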